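import HarnessLib
import Summits.NavierStokesRegularity.NavierStokesRegularity.Theses.QuarterLogPincer
import Summits.NavierStokesRegularity.NavierStokesRegularity.Theorems.QuarterLogPincerTypeIQuantSubcubicExpABRoot
import Summits.NavierStokesRegularity.NavierStokesRegularity.Theorems.QuarterTurnRdssNoSilentTypeIProfile
import Summits.NavierStokesRegularity.NavierStokesRegularity.Theorems.QuarterLogPincerTypeIQuantSubcubicExpTruncationEdgeRateFloor

/-!
# LINE `cubic_rung` (ns-idea-7 g11, lens «nearmiss», target «DSS wall») — crux
`QuarterLogPincer.TypeIQuantSubcubicExp` (stmt-NavierStokesRegularity-24077, LADDER-NS wall W7)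

**No summit is proved by this line.**  It files ONE NEW RUNG strictly below the crux and wires it,
kernel-checked, into the crux's existing left edge (`ab_root`).

## The near-miss of record and its measured deficit

* Near-miss: Barker–Prange 2021, Prop. 2 / Thm. 1 — for «smooth with sufficient decay» solutions with
  the WEAK-`L³` Type-I bound `‖u‖_{L^∞_t L^{3,∞}_x} ≤ M`, the final-time amplification obeys
  `log F ≤ ½·exp(exp(M^{1024}))·(local L³ cube)`, i.e. `log F_M(A) = O_M(A³)` (the crux docstring's
  «NUMBERS» line) [corpus:paper:arxiv-2003.06717 p.10 Prop. 2; Literature fact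
  `barkerPrange2021_typeI_log_rate`].
* Deficit 1 (GAUGE — the crux docstring's own «CAVEAT (typing)»): BP21 is stated in the weak-`L³`
  gauge; the crux lives in the SUP-RATE gauge `‖u(t,x)‖ ≤ M (T+τ−t)^{-1/2}` + `L³` history `≤ A`.
  The two Type-I notions are NOT known to be comparable (Barker–Prange survey, footnote to the list of
  Type-I notions: «it is not even clear that ODE-type-I implies the generalized notion»)
  [corpus:paper:arxiv-2211.16215 p.8; p.14 §7].  Reading BP21's proof for its uses of the gauge:
  Lemma 4 (backward propagation of concentration) uses `L^{3,∞}` ONLY through `L^{3,∞} ⊂ L²_uloc`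
  (constant `C_weak`) [ibid. 2003.06717 p.12, p.26] — transports to the rate gauge via the LEAD's
  registered (I1) `UniformScaledEnergy`; Lemma 27 (epochs of regularity, Type I) [p.34] is FREE in the
  rate gauge (every slice is `L^∞`-bounded by `M(T+τ−t)^{-1/2}`); the FIRST NON-TRANSFERRING STEP is
  Lemma 20 / Cor. 21 (quantitative ANNULUS of regularity, Type I) [p.32]: its pigeonhole over thick
  annuli uses GLOBAL integrability of the weak-`L³` slice (`L^{3,∞} ⊂ L^{3−δ} + L^{3+δ}`), which in the
  rate gauge is available only at level `A` (`‖u(t)‖₃ ≤ A`), giving annuli of width `exp(C·A^c)` and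
  hence `log F ≲ expexp(A^c)·A³` — NOT `O_M(A³)`.  (The rate gauge allows up to `(A/M)³` far-away
  Type-I «beads» per slice; weak-`L³ ≤ M` allows `O(1)`.)
* Deficit 2 (`O → o`) is the crux itself and is NOT touched here.

So in the crux's own gauge the baseline `log F_M(A) = O_M(A³)` is NOT in print: it is a RUNG.

## The rung and its wiring (all edges below are theorems of this file unless marked STUB/OPEN)

`R := TypeIQuantCubicExp` («log F_M(A) ≤ K_M·A³ in the sup-rate gauge»), typed verbatim on the crux's
frame with `F A := exp(K A³)`.
* `TypeIQuantSubcubicExp → R`            (`typeIQuantCubicExp_of_typeIQuantSubcubicExp`; so ¬R kills 24077).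
* `SmallBudgetTowerLiouville → R`         (`typeIQuantCubicExp_of_smallBudgetTowerLiouville`): a BUDGET
  FLOOR `q ≥ q₀(M) > 0` for thin singular A–B towers suffices — via the per-`M` pigeonhole
  `quantCubicExpAt_of_forbiddenLength` (ONE forbidden cheap-cascade length at ONE budget gives the cubic
  bound, constant `K = (2K₀+2)/8 + 1/q`) and the LEAD's landed extraction
  `AbRoot.exists_thin_singular_abTower_of_cheapCascades`.
* `AbRoot.ThinTowerLiouville → SmallBudgetTowerLiouville → …` and `ThinTowerLiouville →
  ZeroTraceTowerLiouville` (forgetful edges): the rung's left hypothesis is the SMALL-BUDGET corner of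
  the LEAD's left hypothesis, and its `q = 0` endpoint `Z := ZeroTraceTowerLiouville` («a thin singular
  A–B tower cannot have ZERO outer trace») is where the content sits:
  - `Z → SmallBudgetTowerLiouvilleE` — STUB C2a `stub_budgetCompactnessE` (M–L; A–B compactness as
    `q ↓ 0` AT A FIXED LOCAL-ENERGY LEVEL `E` + closedness of the apex singularity via UNIFORM-ONSET
    loudness); v1.1 (audit v5 of ns-afl-r1, evidence #54/#55): the floor R consumes is the
    ENERGY-EXPOSED one (`SmallBudgetTowerLiouvilleE`, `q₀ = q₀(M,E)`; `ThinObjectE` = the LEAD's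
    `ThinObject` with its `∃ E` exposed), fed by STUB C2e `stub_extractionEnergy` (S/M: the LEAD's landed
    extraction re-run with the energy level tracked, `E ≤ C(M)` from the proved (I1)
    `UniformScaledEnergy` by Fatou) — `typeIQuantCubicExp_of_smallBudgetTowerLiouvilleE`;
  - `Z` in the ENVELOPED class — decided NOW modulo the S/M bridge STUB `stub_annulusVanishing`
    (`no_enveloped_zeroTrace_thinObject`, from tree `NoSilentTypeIProfile.eq_zero_of_annulus_vanishing`
    + T4 `TruncationEdge.rateFloor_of_isTypeIAncientMild_of_singularAt`);
  - `Z` in general = (printed ESS regime, STUB `stub_essRegime`: far-field bounded up to the final time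
    ⇒ backward uniqueness in the exterior + unique continuation [Escauriaza–Seregin–Šverák 2003;
    Seregin LN 2014 pp.186–188]) ∘ (OPEN kernel `ZeroOuterTraceFarField`: zero OUTER trace ⇒ far-field
    bounded — Seregin LN 2014 p.187 «we need more regularity for sufficiently large x», the exterior-data
    form of ns-idea-18's `ZeroTraceFarFieldAB`) — `zeroTraceTowerLiouville_of_farField`.

## Why this line / why novel vs the listed routes and lines
* vs `ab_root` (g8, landed): ab_root's edge is `ThinTowerLiouville → 24077` (all budgets `q > 0`); this
  line isolates the `q ↓ 0` corner and shows it ALREADY pays for a statement nobody had typed (R), with a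
  per-`M` pigeonhole that needs ONE forbidden length instead of one per budget.
* vs `trace_floor` (g7): its `ThinEnvelopeFloor κ` is a QUANTITATIVE single-exp floor on the c-DSS +
  envelope SUBCLASS aimed at the `o(A³)` crux; `SmallBudgetTowerLiouville` is the QUALITATIVE floor on the
  WHOLE thin-tower class and is exactly what R consumes.  NEARMISS-CENSUS-g7 row 28 («cubic ceiling
  KNOWN») is hereby CORRECTED: known in the weak-`L³` gauge only.
* vs ns-idea-18 `FinalTrace` (23843 side): same printed open kernel (Seregin p.187), but EXTERIOR data
  (trace unknown inside the unit ball, `SingularAt 0` instead of `HasZeroTraceOn univ`) and a different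
  consumer (R on 24077's board, not FDC on 23843's).
* vs routes QuarterLogPincer / TypeIQuarterGate / pub-ns-dss instrument: no DSS hypothesis anywhere; the
  rung sits BELOW the DSS wall (a DSS blow-up with per-octave trace `q_DSS > 0` satisfies R with
  `K ≥ 1/(2 q_DSS)`), so it is bankable progress that the wall cannot veto.
* bears_on: LADDER-NS W7 (24077) — new rung id proposal «W7.R0-rate: cubic amplification bound in the
  sup-rate gauge»; director-ns to place.
* Cheapest falsifier: (a) a printed/landed theorem giving `log F ≤ K_M A³` under the sup-rate bound alone
  (makes R KNOWN — searched: none; BP21/Tao give `expexp(A^c)`-type bounds in this gauge); (b) a thin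
  singular A–B tower with zero outer trace (kills Z, R's route (L), and — via `stub_budgetCompactnessE` —
  nothing more: R could still hold by route (G), now typed as line `bead_census`); (c) `#h21_crux_probe` on R / SmallBudget / Z (run: see
  card).
* Instrument row (pub-ns-dss): unchanged — a backward-DSS profile with small per-octave trace `q` is the
  object whose `q ↓ 0` limit this line says cannot be silent outside the unit ball.
* Route (G) (not typed here, recorded for the LEAD): transport BP21 §3 to the rate gauge; single input =
  an annulus-of-regularity lemma with `M`-only width under (sup-rate `M`, `L³ ≤ A`) — a «bead-sparsity»
  pigeonhole (total bead cube `≤ A³` across all scales ⇒ most concentration scales own a bead-free thick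
  annulus).  Size L/XL; first obstacle named above (BP21 Lemma 20).
-/

set_option linter.dupNamespace false

namespace Summit.NavierStokesRegularity.NavierStokesRegularity.Cruxes.TypeIQuantSubcubicExp.CubicRung

open MeasureTheory Set Function Filter Topology Metric
open scoped ENNReal NNReal InnerProductSpace RealInnerProductSpace
open Literature.Analysis Literature.Analysis.FluidPDE
open Summit.NavierStokesRegularity.NavierStokesRegularity.Cruxes.TypeIQuantSubcubicExp.ThinCascade
open Summit.NavierStokesRegularity.NavierStokesRegularity.Theorems.ThinCascade
open Summit.NavierStokesRegularity.NavierStokesRegularity.Cruxes.TypeIQuantSubcubicExp.AbRoot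
open Summit.NavierStokesRegularity.NavierStokesRegularity.Cruxes.ScarEnvelopeTypeI.ZoomDictionary

local notation "E3" => EuclideanSpace ℝ (Fin 3)

/-! ## 1. The rung `R` -/

/-- **The cubic amplification bound AT Type-I constant `M` (sup-rate gauge).**  There is `K = K(M)` such
that every Tao-frame solution with the virtual Type-I bound `‖u(t,x)‖ ≤ M (T+τ−t)^{-1/2}` and `L³` history
`≤ A` (`A ≥ 2`) obeys `‖u(t,x)‖ ≤ exp(K A³) t^{-1/2}` — the crux's bound clause with `F(A) := exp(K A³)`.
Why it might fail: a sequence of thin singular towers with outer-trace budgets `q ↓ 0` (equivalently,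
unboundedly CHEAP cascades at fixed `M`) — the `q = 0` endpoint object `ZeroTraceTowerLiouville` forbids.
Sources: [corpus:paper:arxiv-2003.06717 p.10 Prop. 2 (weak-L³ gauge)], [corpus:paper:arxiv-2211.16215
p.8 footnote, p.14 §7]. -/
def QuantCubicExpAt (M : ℝ) : Prop :=
  ∃ K : ℝ, ∀ (T τ A : ℝ) (u : ℝ → E3 → E3) (p : ℝ → E3 → ℝ),
    (IsClassicalNSSolutionOn (Icc 0 T) 1 0 u p ∧
        ∀ n : ℕ, ∃ C : NNReal, ∀ t ∈ Icc 0 T, eLpNorm (iteratedFDeriv ℝ n (u t)) 2 volume ≤ C) →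
      0 < τ →
      (∀ t ∈ Icc 0 T, ∀ x : E3, ‖u t x‖ ≤ M * (T + τ - t) ^ (-(1 / 2 : ℝ))) →
      (∀ t ∈ Icc 0 T, eLpNorm (u t) 3 volume ≤ ENNReal.ofReal A) → 2 ≤ A →
      ∀ t ∈ Ioc 0 T, ∀ x : E3, ‖u t x‖ ≤ Real.exp (K * A ^ 3) * t ^ (-(1 / 2 : ℝ))

/-- **R = `TypeIQuantCubicExp`** — the rung: `log F_M(A) ≤ K_M A³` for every Type-I constant `M`, in the
crux's own (sup-rate) gauge.  KNOWN in the weak-`L³` gauge (BP21 Prop. 2); NOT in print in this gauge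
(first non-transferring step: BP21 Lemma 20, annulus of regularity). -/
def TypeIQuantCubicExp : Prop := ∀ M : ℝ, QuantCubicExpAt M

/-- `R` is literally weaker than the crux: `o(A³)` at `ε = 1` gives `O(A³)` with
`K := 1 + |A₀(1)|³/8` (monotonicity of the `L³`-history clause in `A`). -/
theorem typeIQuantCubicExp_of_typeIQuantSubcubicExp
    (h : Summit.NavierStokesRegularity.NavierStokesRegularity.Theses.QuarterLogPincer.TypeIQuantSubcubicExp) :
    TypeIQuantCubicExp := by
  intro M
  obtain ⟨F, hF, hbd⟩ := h M
  obtain ⟨A₀, hA₀⟩ := hF 1 one_pos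
  refine ⟨1 + |A₀| ^ 3 / 8, ?_⟩
  intro T τ A u p hframe hτ htypeI hL3 hA t ht x
  -- enlarge the history level to `A' := max A A₀`
  have hAA' : A ≤ max A A₀ := le_max_left _ _
  have hL3' : ∀ s ∈ Icc 0 T, eLpNorm (u s) 3 volume ≤ ENNReal.ofReal (max A A₀) := fun s hs =>
    (hL3 s hs).trans (ENNReal.ofReal_le_ofReal hAA')
  have hA' : 2 ≤ max A A₀ := hA.trans hAA'
  have hbound := hbd T τ (max A A₀) u p hframe hτ htypeI hL3' hA' t ht x
  have hFle : F (max A A₀) ≤ Real.exp (1 * (max A A₀) ^ 3) := hA₀ _ (le_max_right _ _)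
  have hcube : 1 * (max A A₀) ^ 3 ≤ (1 + |A₀| ^ 3 / 8) * A ^ 3 := by
    have hA3 : 8 ≤ A ^ 3 := by
      calc (8 : ℝ) = 2 ^ 3 := by norm_num
        _ ≤ A ^ 3 := by gcongr
    have habs : 0 ≤ |A₀| ^ 3 := by positivity
    rcases le_total A₀ A with hle | hle
    · rw [max_eq_left hle]
      nlinarith
    · rw [max_eq_right hle]
      have hA₀pos : 0 ≤ A₀ := by linarith
      have h1 : A₀ ^ 3 = |A₀| ^ 3 := by rw [abs_of_nonneg hA₀pos]
      have h2 : |A₀| ^ 3 ≤ |A₀| ^ 3 / 8 * A ^ 3 := by nlinarith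
      nlinarith
  have ht0 : 0 ≤ t ^ (-(1 / 2 : ℝ)) := Real.rpow_nonneg ht.1.le _
  calc ‖u t x‖ ≤ F (max A A₀) * t ^ (-(1 / 2 : ℝ)) := hbound
    _ ≤ Real.exp (1 * (max A A₀) ^ 3) * t ^ (-(1 / 2 : ℝ)) := mul_le_mul_of_nonneg_right hFle ht0
    _ ≤ Real.exp ((1 + |A₀| ^ 3 / 8) * A ^ 3) * t ^ (-(1 / 2 : ℝ)) :=
        mul_le_mul_of_nonneg_right (Real.exp_le_exp.2 hcube) ht0

/-! ## 2. The per-`M` pigeonhole: ONE forbidden cheap-cascade length gives the cubic bound -/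

/-- **C1 (proved).**  If at SOME budget `q > 0` SOME length `K₀` admits no cheap cascade
`CheapCascade M q K₀`, then `QuantCubicExpAt M` with `K = (2K₀+2)/8 + 1/q`: every admissible value
`‖u(t,x)‖√t` is `< exp(2K₀ + A³/q + 2) ≤ exp(K A³)` by the LEAD's landed `cheapCascade_of_violator`
(contrapositive) and `A³ ≥ 8`.  Compare `quantSubcubicExpAt_of_forbiddenLengths` (needs a forbidden
length at EVERY budget). -/
theorem quantCubicExpAt_of_forbiddenLength (M : ℝ)
    (h : ∃ q : ℝ, 0 < q ∧ ∃ K₀ : ℕ, ¬ CheapCascade M q K₀) : QuantCubicExpAt M := by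
  obtain ⟨q, hq, K₀, hK₀⟩ := h
  refine ⟨(2 * K₀ + 2) / 8 + 1 / q, ?_⟩
  intro T τ A u p hframe hτ htypeI hL3 hA t ht x
  have key : ‖u t x‖ * Real.sqrt t < Real.exp (2 * K₀ + A ^ 3 / q + 2) := by
    by_contra hle
    exact hK₀ (cheapCascade_of_violator hframe hτ htypeI hL3 (by linarith) hq ht (not_lt.1 hle))
  have hexp : Real.exp (2 * K₀ + A ^ 3 / q + 2) ≤ Real.exp (((2 * K₀ + 2) / 8 + 1 / q) * A ^ 3) := by
    refine Real.exp_le_exp.2 ?_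
    have hA3 : 8 ≤ A ^ 3 := by
      calc (8 : ℝ) = 2 ^ 3 := by norm_num
        _ ≤ A ^ 3 := by gcongr
    have hK : (0 : ℝ) ≤ 2 * K₀ + 2 := by positivity
    have e : ((2 * K₀ + 2) / 8 + 1 / q) * A ^ 3 = (2 * K₀ + 2) / 8 * A ^ 3 + A ^ 3 / q := by ring
    rw [e]
    nlinarith
  exact le_mul_rpow_neg_half_of_mul_sqrt_le ht.1 (key.le.trans hexp)

/-! ## 3. The budget floor and the edge `SmallBudgetTowerLiouville → R` -/

/-- **BUDGET FLOOR for thin singular A–B towers.**  For every Type-I constant `M` there is `q₀(M) > 0`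
such that no KNSS limit is simultaneously a thin object with outer-trace budget `q < q₀` and a Type-I
ancient mild A–B tower while failing to be regular at the origin — the SMALL-BUDGET corner of
`AbRoot.ThinTowerLiouville`.  Why it might fail: towers with ever cheaper outer traces (their `q ↓ 0`
limit is a ZERO-outer-trace singular tower, cf. `ZeroTraceTowerLiouville`).  KNOWN in the weak-`L³`
gauge for DSS (BP21 Cor. 1, `q₀ = exp(-exp(M^{1025}))`-type) [corpus:paper:arxiv-2003.06717 p.4];
OPEN here. -/
def SmallBudgetTowerLiouville : Prop :=
  ∀ M : ℝ, ∃ q₀ : ℝ, 0 < q₀ ∧ ∀ q : ℝ, 0 < q → q < q₀ →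
    ∀ (W : ℝ → E3 → E3) (g : E3 → E3) (P : ℝ → E3 → ℝ) (H : ℝ → E3 → E3 →L[ℝ] E3),
      ThinObject M q W g → ABTower M W P H → RegPt W 0

/-- Forgetful edge: the LEAD's left hypothesis gives the floor (with `q₀ = 1`). -/
theorem smallBudgetTowerLiouville_of_thinTowerLiouville (hL : ThinTowerLiouville) :
    SmallBudgetTowerLiouville :=
  fun M => ⟨1, one_pos, fun q hq _ W g P H hthin hAB => hL M q hq W g P H hthin hAB⟩

/-- **THE RUNG'S LEFT EDGE (kernel-checked, no stub): `SmallBudgetTowerLiouville → TypeIQuantCubicExp`.**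
At `M`: take the budget `q₀/2`; if every length had a cheap cascade at that budget, the LEAD's extraction
`exists_thin_singular_abTower_of_cheapCascades` would produce a thin singular A–B tower with budget
`q₀/2 < q₀`, which the floor forbids; so some length is forbidden and C1 applies. -/
theorem typeIQuantCubicExp_of_smallBudgetTowerLiouville (h : SmallBudgetTowerLiouville) :
    TypeIQuantCubicExp := by
  intro M
  obtain ⟨q₀, hq₀, hL⟩ := h M
  refine quantCubicExpAt_of_forbiddenLength M ⟨q₀ / 2, half_pos hq₀, ?_⟩
  by_contra hall
  push Not at hall
  obtain ⟨W, g, P, H, hthin, hAB, hreg⟩ := exists_thin_singular_abTower_of_cheapCascades (half_pos hq₀) hall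
  exact hreg (hL (q₀ / 2) (half_pos hq₀) (half_lt_self hq₀) W g P H hthin hAB)

/-! ## 4. The `q = 0` endpoint `Z` -/

/-- **Z = ZERO-OUTER-TRACE TOWER LIOUVILLE.**  A KNSS limit which is a thin object with ZERO outer-trace
budget (`ThinObject M 0 W g`: the weak final trace `g` has `∫_{1<|x|<R} |g|³ = 0` for every `R`, i.e.
`g = 0` a.e. OUTSIDE the unit ball; nothing is asked inside) and a Type-I ancient mild A–B tower is
regular at the origin.  The exterior-data form of the printed open question (Seregin LN 2014 §6.6
p.187, comments after Thm 6.21; ns-idea-18's `ZeroTraceLiouvilleAB` asks zero trace on ALL of `ℝ³`).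
Why it might fail: critical `M/√(-s)` coefficients defeat linear backward uniqueness — a nonzero tower
could in principle regenerate from spatial infinity while depositing nothing outside the unit ball at the
final time.  DECIDED in the enveloped class (`no_enveloped_zeroTrace_thinObject` below, modulo the
bridge stub) and in the ESS far-field-bounded regime (stub `stub_essRegime`, print). -/
def ZeroTraceTowerLiouville : Prop :=
  ∀ (M : ℝ) (W : ℝ → E3 → E3) (g : E3 → E3) (P : ℝ → E3 → ℝ) (H : ℝ → E3 → E3 →L[ℝ] E3),
    ThinObject M 0 W g → ABTower M W P H → RegPt W 0

/-- Budget monotonicity of thin objects. -/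
theorem thinObject_mono_budget {M q q' : ℝ} (hqq' : q ≤ q') {W : ℝ → E3 → E3} {g : E3 → E3}
    (h : ThinObject M q W g) : ThinObject M q' W g := by
  obtain ⟨h1, h2, h3, h4, h5, h6⟩ := h
  refine ⟨h1, h2, h3, h4, h5, fun R hR => (h6 R hR).trans (ENNReal.ofReal_le_ofReal ?_)⟩
  have hlog : 0 ≤ 1 + Real.log R := by
    have := Real.log_nonneg hR
    linarith
  exact mul_le_mul_of_nonneg_right hqq' hlog

/-- Forgetful edge: `ThinTowerLiouville → Z` (a zero-budget thin object is a budget-`1` thin object). -/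
theorem zeroTraceTowerLiouville_of_thinTowerLiouville (hL : ThinTowerLiouville) :
    ZeroTraceTowerLiouville :=
  fun M W g P H h0 hAB => hL M 1 one_pos W g P H (thinObject_mono_budget zero_le_one h0) hAB

/-! ### 3♯. The ENERGY-EXPOSED floor (v1.1 — ns-afl-r1 audit v5 (a), evidence #54: the `qₙ ↓ 0`
compactness needs a UNIFORM local-energy level along the sequence; `ThinObject M q W g` hides the level
behind `∃ E`, so a floor quantified over ALL thin towers at once cannot be reached by compactness.  The
repair types the level.) -/

/-- The LEAD's `ThinObject` with its local-energy level `E` EXPOSED (every other clause verbatim: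
Type-I ancient mild, `SingularAt v 0`, locally integrable weak final trace `g`, log-thin annular cube
budget `q`). -/
def ThinObjectE (M q E : ℝ) (v : ℝ → E3 → E3) (g : E3 → E3) : Prop :=
  IsTypeIAncientMild M v ∧
    (∀ x₀ : E3, ∀ t ∈ Ioo (-1 : ℝ) 0,
      ∫⁻ y in ball x₀ 1, ENNReal.ofReal (‖v t y‖ ^ 2) ≤ ENNReal.ofReal E) ∧
    SingularAt v 0 ∧
    LocallyIntegrable g volume ∧
    (∀ φ : E3 → E3, ContDiff ℝ (⊤ : ℕ∞) φ → HasCompactSupport φ →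
      Tendsto (fun t => ∫ x, inner ℝ (v t x) (φ x)) (𝓝[<] 0) (𝓝 (∫ x, inner ℝ (g x) (φ x)))) ∧
    ∀ R : ℝ, 1 ≤ R →
      ∫⁻ x in {x : E3 | 1 < ‖x‖ ∧ ‖x‖ < R}, ENNReal.ofReal (‖g x‖ ^ 3)
        ≤ ENNReal.ofReal (q * (1 + Real.log R))

theorem thinObject_iff_exists_thinObjectE {M q : ℝ} {v : ℝ → E3 → E3} {g : E3 → E3} :
    ThinObject M q v g ↔ ∃ E : ℝ, ThinObjectE M q E v g := by
  constructor
  · rintro ⟨h1, ⟨E, hE⟩, h3, h4, h5, h6⟩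
    exact ⟨E, h1, hE, h3, h4, h5, h6⟩
  · rintro ⟨E, h1, hE, h3, h4, h5, h6⟩
    exact ⟨h1, ⟨E, hE⟩, h3, h4, h5, h6⟩

theorem thinObjectE_mono_budget {M q q' E : ℝ} (hqq' : q ≤ q') {W : ℝ → E3 → E3} {g : E3 → E3}
    (h : ThinObjectE M q E W g) : ThinObjectE M q' E W g := by
  obtain ⟨h1, h2, h3, h4, h5, h6⟩ := h
  refine ⟨h1, h2, h3, h4, h5, fun R hR => (h6 R hR).trans (ENNReal.ofReal_le_ofReal ?_)⟩
  have hlog : 0 ≤ 1 + Real.log R := by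
    have := Real.log_nonneg hR
    linarith
  exact mul_le_mul_of_nonneg_right hqq' hlog

/-- **ENERGY-EXPOSED BUDGET FLOOR** (the floor R actually consumes, v1.1): for every Type-I constant `M`
and every local-energy LEVEL `E` there is `q₀ = q₀(M,E) > 0` such that no thin singular A–B tower at
`(M, E)` has outer-trace budget `q < q₀`.  Why it might fail: as `SmallBudgetTowerLiouville` (towers with
ever cheaper outer traces at a FIXED energy level; their limit is a zero-outer-trace singular tower, which
`ZeroTraceTowerLiouville` forbids).  Sources: [corpus:paper:arxiv-2003.06717 p.4 Cor. 1 (weak-L³, DSS)];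
A–B 2019 Rem. 3.2 (arXiv:1811.00502 p.7) for why the energy level must be carried. -/
def SmallBudgetTowerLiouvilleE : Prop :=
  ∀ M E : ℝ, ∃ q₀ : ℝ, 0 < q₀ ∧ ∀ q : ℝ, 0 < q → q < q₀ →
    ∀ (W : ℝ → E3 → E3) (g : E3 → E3) (P : ℝ → E3 → ℝ) (H : ℝ → E3 → E3 →L[ℝ] E3),
      ThinObjectE M q E W g → ABTower M W P H → RegPt W 0

/-- The energy-uniform floor implies the energy-exposed one. -/
theorem smallBudgetTowerLiouvilleE_of_smallBudgetTowerLiouville (h : SmallBudgetTowerLiouville) :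
    SmallBudgetTowerLiouvilleE := by
  intro M E
  obtain ⟨q₀, hq₀, hL⟩ := h M
  exact ⟨q₀, hq₀, fun q hq hqq W g P H hthin hAB =>
    hL q hq hqq W g P H (thinObject_iff_exists_thinObjectE.2 ⟨E, hthin⟩) hAB⟩

/-- **C2e — EXTRACTION WITH THE ENERGY LEVEL TRACKED** (STUB `stub_extractionEnergy`, size S/M, no wall):
at each `M` there is ONE level `E = E(M)` such that cheap cascades of every length at any budget `q > 0`
produce a thin singular A–B tower AT LEVEL `E`.  This is the LEAD's landed
`AbRoot.exists_thin_singular_abTower_of_cheapCascades` with the constant it already computes made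
visible: the zoom limit's local energy is `≤ C(M)` by Fatou from the PROVED (I1) `UniformScaledEnergy`
(tree `QuarterLogPincerTypeIQuantSubcubicExpZoomEnergyLimit`), but the landed conclusion `ThinObject M q W g`
re-hides it behind `∃ E`.  Why it might fail: it cannot, short of a mismatch between the zoom normalisation
and the unit ball of the energy clause (the landed proof fixes both).  Sources: tree files named. -/
def ExtractionEnergy : Prop :=
  ∀ M : ℝ, ∃ E : ℝ, ∀ q : ℝ, 0 < q → (∀ K : ℕ, CheapCascade M q K) →
    ∃ (W : ℝ → E3 → E3) (g : E3 → E3) (P : ℝ → E3 → ℝ) (H : ℝ → E3 → E3 →L[ℝ] E3),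
      ThinObjectE M q E W g ∧ ABTower M W P H ∧ ¬ RegPt W 0

theorem stub_extractionEnergy : ExtractionEnergy := by
  sorry

/-- **THE RUNG'S LEFT EDGE, energy-exposed form (kernel-checked modulo C2e):**
`ExtractionEnergy → SmallBudgetTowerLiouvilleE → TypeIQuantCubicExp`.  At `M`: take the level `E(M)` of
C2e and the budget `q₀(M,E)/2`; if every length had a cheap cascade at that budget, C2e would produce a
thin singular A–B tower at level `E` with budget `< q₀`, which the floor forbids; so some length is
forbidden and C1 applies. -/
theorem typeIQuantCubicExp_of_smallBudgetTowerLiouvilleE (hext : ExtractionEnergy)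
    (h : SmallBudgetTowerLiouvilleE) : TypeIQuantCubicExp := by
  intro M
  obtain ⟨E, hE⟩ := hext M
  obtain ⟨q₀, hq₀, hL⟩ := h M E
  refine quantCubicExpAt_of_forbiddenLength M ⟨q₀ / 2, half_pos hq₀, ?_⟩
  by_contra hall
  push Not at hall
  obtain ⟨W, g, P, H, hthin, hAB, hreg⟩ := hE (q₀ / 2) (half_pos hq₀) hall
  exact hreg (hL (q₀ / 2) (half_pos hq₀) (half_lt_self hq₀) W g P H hthin hAB)

/-- **C2a — STUB `stub_budgetCompactnessE` (size M–L; no wall): `Z → SmallBudgetTowerLiouvilleE`.**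
If at FIXED `(M, E)` there were thin singular A–B towers `(Wₙ, gₙ, Pₙ, Hₙ)` with budgets `qₙ ↓ 0`: the
uniform level `E` gives A–B compactness (the LEAD's landed twin-zoom-limit tools one level down: Type-I
ancient mild + local energy `≤ E` + `𝐈 < ∞` pass to locally-strong limits; weak final traces converge
weakly; the annular cube budget is weakly lower semicontinuous, so the limit has budget `0`), and the limit
is SINGULAR AT THE APEX by UNIFORM-ONSET loudness — `∀ M, ∃ c > 0, ∀ E, ∃ s₀ < 0, ∀ v` thin singular at
`(M,E)`, `∀ s ∈ [s₀,0), ∃ x ∈ B(0,1), c/√(-s) ≤ ‖v s x‖`, scale-covariant, hence surviving locally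
uniform convergence at every scale (ns-afl-r1 audit v5 add1, evidence #55; in the ENVELOPED sub-class this
closedness is the tree's `Theorems/TypeIQuantSubcubicExp/Negative/QuietCoreApexClosed`
`singularAt_zero_of_limit_envelopedSingular` once landed (announced p-pending 2026-08-29); in the thin class
it is workfile `Lines/quiet_core.lean` §7 `uniformFloor_logCube` re-typed with uniform onset) — a thin
singular tower at level `E` with budget `0`, contradicting `Z`.  Why it might fail: existence of the
limit's weak final trace and Aubin–Lions up to the final time need the level `E` (now a hypothesis) and
the LEAD's (I2)-type final-window continuity; no further gap is known.  Sources: tree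
`AbRoot.exists_thin_singular_abTower_of_cheapCascades`, `AbRootRooting` (compactness one level down),
[corpus:book:seregin2014 §6.2–6.3] (stability of singular points), Lin 1998. -/
theorem stub_budgetCompactnessE : ZeroTraceTowerLiouville → SmallBudgetTowerLiouvilleE := by
  sorry

/-- Composition through the stubs C2e, C2a: `Z → R`. -/
theorem typeIQuantCubicExp_of_zeroTraceTowerLiouville (hZ : ZeroTraceTowerLiouville) :
    TypeIQuantCubicExp :=
  typeIQuantCubicExp_of_smallBudgetTowerLiouvilleE stub_extractionEnergy (stub_budgetCompactnessE hZ)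

/-! ## 5. `Z` decided in the ENVELOPED class (tree engine `NoSilentTypeIProfile`) -/

private theorem ancientMild_mono {C C' : ℝ} {W : ℝ → E3 → E3} (h : IsTypeIAncientMild C W)
    (hCC' : C ≤ C') : IsTypeIAncientMild C' W :=
  ⟨h.1, h.2.1, h.2.2.1, fun t ht x => (h.2.2.2 t ht x).trans
    (div_le_div_of_nonneg_right hCC' (Real.sqrt_nonneg _))⟩

private theorem decay_mono {C C' : ℝ} {W : ℝ → E3 → E3} (h : HasTypeIDecay C W) (hCC' : C ≤ C') :
    HasTypeIDecay C' W := fun t ht x =>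
  (h t ht x).trans (div_le_div_of_nonneg_right hCC' (by positivity))

/-- **C3 — STUB `stub_annulusVanishing` (size S/M; no wall): the zero weak outer trace of an ENVELOPED
thin object upgrades to `L¹`-vanishing on every bounded outer annulus.**  From `ThinObject M 0 W g`:
`g = 0` a.e. on `{1 < |x|}` (budget clause at `q = 0`) and `W(t) ⇀ g` against smooth compactly supported
fields; from the envelope `‖W(t,x)‖ ≤ C/(|x| + √(-t)) ≤ C` off the origin and interior parabolic
regularity of mild bounded ancient solutions (tree `TypeIAncientMildClassical` / ESS local Hölder
`ESSLocalHolderVorticityC12`) the family `{W(t)}_{t<0}` is equicontinuous on `{1 < |x| < r}`; weak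
convergence to `0` + equicontinuity + uniform bound ⇒ uniform, hence `L¹`, convergence to `0` there.
Why it might fail: only a bookkeeping mismatch between the weak-trace clause (smooth compactly supported
tests on `ℝ³`) and tests supported in the open annulus — none: the latter are among the former.
[folklore: Arzelà–Ascoli; cite: EscauriazaSereginSverak2003 (interior regularity of bounded mild)] -/
theorem stub_annulusVanishing :
    ∀ (M C : ℝ) (W : ℝ → E3 → E3) (g : E3 → E3), ThinObject M 0 W g → HasTypeIDecay C W →
      ∀ r : ℝ, 1 < r → Tendsto
        (fun t => ∫⁻ x in {x : E3 | 1 < ‖x‖ ∧ ‖x‖ < r}, ‖W t x‖ₑ) (𝓝[<] 0) (𝓝 0) := by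
  sorry

/-- **`Z` in the enveloped class (kernel-checked through C3): NO enveloped thin object has zero outer
trace.**  With `C₀ := max M C`, tree `NoSilentTypeIProfile.eq_zero_of_annulus_vanishing` (KNSS-gauge
Type-I field + envelope + annulus vanishing at `ρ = 1` ⇒ `W ≡ 0` on the past) contradicts `SingularAt W 0`
through T4's rate floor `rateFloor_of_isTypeIAncientMild_of_singularAt` (`∃ x, c/√(1/2) ≤ ‖W(-1/2,x)‖`). -/
theorem no_enveloped_zeroTrace_thinObject {M C : ℝ} {W : ℝ → E3 → E3} {g : E3 → E3}
    (h0 : ThinObject M 0 W g) (hdec : HasTypeIDecay C W) : False := by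
  have hV : IsTypeIAncientMild (max M C) W := ancientMild_mono h0.1 (le_max_left _ _)
  have hdec' : HasTypeIDecay (max M C) W := decay_mono hdec (le_max_right _ _)
  have hzero : ∀ t < 0, ∀ x, W t x = 0 :=
    Summit.NavierStokesRegularity.NavierStokesRegularity.Theorems.NoSilentTypeIProfile.eq_zero_of_annulus_vanishing
      hV hdec' one_pos (stub_annulusVanishing M C W g h0 hdec)
  obtain ⟨c, hc, hfloor⟩ :=
    Summit.NavierStokesRegularity.NavierStokesRegularity.Cruxes.TypeIQuantSubcubicExp.TruncationEdge.rateFloor_of_isTypeIAncientMild_of_singularAt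
  obtain ⟨x, hx⟩ := hfloor M W h0.1 h0.2.2.1 (-(1 / 2 : ℝ)) ⟨by norm_num, by norm_num⟩
  rw [hzero _ (by norm_num) x, norm_zero] at hx
  have hpos : 0 < c / Real.sqrt (-(-(1 / 2 : ℝ))) := div_pos hc (Real.sqrt_pos.2 (by norm_num))
  linarith

/-- Hence `Z` holds (vacuously) for enveloped towers — the enveloped INSTANCE of the rung's hypothesis. -/
theorem zeroTraceTowerLiouville_enveloped {M C : ℝ} {W : ℝ → E3 → E3} {g : E3 → E3}
    {P : ℝ → E3 → ℝ} {H : ℝ → E3 → E3 →L[ℝ] E3}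
    (h0 : ThinObject M 0 W g) (_hAB : ABTower M W P H) (hdec : HasTypeIDecay C W) : RegPt W 0 :=
  (no_enveloped_zeroTrace_thinObject h0 hdec).elim

/-! ## 6. `Z` in general = printed ESS regime ∘ OPEN far-field kernel -/

/-- Far-field boundedness up to the final time, OUTSIDE some ball (Seregin LN 2014 (6.6.3)-type
hypothesis; ns-idea-18's `FarFieldBdd`, restated here because that sketch is not a tree module). -/
def OuterFarFieldBdd (W : ℝ → E3 → E3) : Prop :=
  ∃ R C : ℝ, ∀ s ∈ Ioo (-1 : ℝ) 0, ∀ x : E3, R ≤ ‖x‖ → ‖W s x‖ ≤ C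

/-- **C4 — STUB `stub_essRegime` (size L; no wall; IN PRINT): a far-field-bounded thin singular A–B tower
cannot have zero outer trace.**  Escauriaza–Seregin–Šverák 2003 assembled as in Seregin LN 2014
pp.186–188: far-field boundedness + interior regularity ⇒ `W, ∇W` bounded on `{|x| > 2R} × (-δ, 0)`;
zero outer trace ⇒ `ω(·,0) = 0` there; half-space backward uniqueness for `|∂ₜω - Δω| ≤ c(|ω| + |∇ω|)`
⇒ `ω ≡ 0` on `{|x| > 2R} × (-δ,0)`; spatial unique continuation (real-analyticity of mild bounded
ancient solutions at negative times) ⇒ `ω ≡ 0` on `ℝ³ × (-δ,0)` ⇒ `W(s)` harmonic and `≤ M/√(-s)` ⇒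
constant in `x` ⇒ (mild, Type-I decay) `W ≡ 0` near the final time, contradicting `SingularAt W 0` via
T4.  Tree engine for the half-space step: `RellichScarApexLocalisation.stub_halfspaceFarFieldCurl`
(proved).  Why it might fail: it does not in print; the work is plumbing (exterior data instead of
ESS's global zero final datum — ESS use the datum only outside a ball). [cite: EscauriazaSereginSverak2003
Thm 1.x; corpus:book:seregin2014 pp.186–188] -/
theorem stub_essRegime :
    ∀ (M : ℝ) (W : ℝ → E3 → E3) (g : E3 → E3) (P : ℝ → E3 → ℝ) (H : ℝ → E3 → E3 →L[ℝ] E3),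
      ThinObject M 0 W g → ABTower M W P H → OuterFarFieldBdd W → RegPt W 0 := by
  sorry

/-- **The OPEN kernel (exterior-data form of Seregin's question / ns-idea-18's `ZeroTraceFarFieldAB`):
a thin A–B tower with ZERO outer trace is far-field bounded up to the final time.**  Not a stub of this
line (it is the open problem the line points at); recorded as a `def` so the factorisation type-checks. -/
def ZeroOuterTraceFarField : Prop :=
  ∀ (M : ℝ) (W : ℝ → E3 → E3) (g : E3 → E3) (P : ℝ → E3 → ℝ) (H : ℝ → E3 → E3 →L[ℝ] E3),
    ThinObject M 0 W g → ABTower M W P H → OuterFarFieldBdd W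

/-- `Z` factors: printed ESS regime (C4) ∘ open far-field kernel. -/
theorem zeroTraceTowerLiouville_of_farField (hker : ZeroOuterTraceFarField) : ZeroTraceTowerLiouville :=
  fun M W g P H h0 hAB => stub_essRegime M W g P H h0 hAB (hker M W g P H h0 hAB)

/-! ## 7. Board (kernel compositions only) -/

/-- The full chain `ZeroOuterTraceFarField → Z → SmallBudgetE → R` (through stubs C4, C2a, C2e). -/
theorem typeIQuantCubicExp_of_zeroOuterTraceFarField (hker : ZeroOuterTraceFarField) :
    TypeIQuantCubicExp :=
  typeIQuantCubicExp_of_zeroTraceTowerLiouville (zeroTraceTowerLiouville_of_farField hker)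

/-- Contrapositive instrument form: if the rung FAILS at some `M`, then at EVERY budget `q > 0` every
length carries a cheap cascade (unboundedly cheap cascades), hence (LEAD extraction) thin singular A–B
towers of every positive budget exist at that `M`. -/
theorem cheapCascades_of_not_quantCubicExpAt {M : ℝ} (h : ¬ QuantCubicExpAt M) :
    ∀ q : ℝ, 0 < q → ∀ K : ℕ, CheapCascade M q K := by
  intro q hq K
  by_contra hK
  exact h (quantCubicExpAt_of_forbiddenLength M ⟨q, hq, K, hK⟩)

theorem thinTowers_of_not_quantCubicExpAt {M : ℝ} (h : ¬ QuantCubicExpAt M) :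
    ∀ q : ℝ, 0 < q → ∃ (W : ℝ → E3 → E3) (g : E3 → E3) (P : ℝ → E3 → ℝ) (H : ℝ → E3 → E3 →L[ℝ] E3),
      ThinObject M q W g ∧ ABTower M W P H ∧ ¬ RegPt W 0 :=
  fun q hq => exists_thin_singular_abTower_of_cheapCascades hq (cheapCascades_of_not_quantCubicExpAt h q hq)

end Summit.NavierStokesRegularity.NavierStokesRegularity.Cruxes.TypeIQuantSubcubicExp.CubicRung
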